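import Mathlib
import HarnessLib
import Literature.AlgebraicGeometry.Ramification.InertiaNormalSylow
import Literature.AlgebraicGeometry.Resolution.ResolutionOfSingularities
import Literature.AlgebraicGeometry.Resolution.BlowupSNC
import Literature.AlgebraicGeometry.Resolution.BoundarySplitting
import Literature.AlgebraicGeometry.Resolution.CanonicalResolutionSmoothCentre
import Summits.ResolutionOfSingularities.ResolutionOfSingularities.Theorems.WildQuotientsWildQuotientResolutionTameMove
import Summits.ResolutionOfSingularities.ResolutionOfSingularities.Theorems.WildQuotientsWildQuotientResolutionStandardFormTransport
import Summits.ResolutionOfSingularities.ResolutionOfSingularities.Theorems.WildQuotientsWildQuotientResolutionStandardFormStableLines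

/-!
# Phase 0 in EVERY dimension for groups with a tame core of prime order: ONE tame move
# (crux `WildQuotients.WildQuotientResolution`, stub `stub_phaseZeroHighDim`)

Crux stmt-ResolutionOfSingularities-15640 (`WildQuotientResolution`), registered stub `stub_phaseZeroHighDim`
(Phase 0 for `dim X′ ≥ 3`: an equivariant proper birational REGULAR model with every inertia group p-closed and a
`G`-stable affine cover). The known all-dimensional slices were `dim X′ ≤ 1` and `G` ITSELF p-closed (identity
model). This file proves the first all-dimensional slice with NON-p-closed stabilisers, by running the
standard-form route of this lineage once:

**Theorem** (`phaseZero_of_primeCore`). Let `G` have a normal subgroup `N` of prime order `ℓ ≠ p` such that every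
subgroup `H ≤ G` WITHOUT a normal Sylow `p`-subgroup contains `N` and has all its elements of order prime to `p`
inside `N` (e.g. every extension of a `p`-group by `C_ℓ`: `S₃` and the dihedral groups `D_ℓ` in characteristic `2`,
`C_ℓ ⋊ C_{p^a}`, … — `hcore_of_quotient_isPGroup`). Then for EVERY crux datum (`X′` integral regular of any
dimension, finite over the separated finite-type `X₁/k`, `char k = p`, faithful action over `q`) the conclusion
of `stub_phaseZeroHighDim` holds: the blow-up `X♯ → X′` of the reduced inert locus `Z_N = {y | N ≤ I_y}`
(✓`tameMove`, p819797) is an equivariant proper birational regular model with a `G`-stable affine cover ALL of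
whose inertia groups are p-closed.

Proof. Let `x ∈ X♯` with `I_x` not p-closed. Then `N ≤ I_x ≤ I_{π x}` (✓`stub_inertia_le`), so `π x ∈ Z_N` and
`x` lies on the exceptional divisor `E = π⁻¹ Z_N`. Since `Z_N` is a regular centre in the regular `X′`
(✓`InertLocusCentre`, `hasSNCWith_nil_of_isRegular`), `[E]` is a simple normal crossings boundary on `X♯`
(✓`HasSNCWith.hasSNC_transform`): `I(E)_x = (t)` with `t` a regular parameter (`t ∈ 𝔪_x ∖ 𝔪_x²`), and `E` is
`G`-stable (`Z_N` is, `N ⊴ G`), so `κ t̄` is an `I_x`-stable line (✓`StandardFormStableLines`, p821951). Every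
element `g ≠ 1` of `I_x` of order prime to `p` lies in `N`, hence generates `N`, so `Z_⟨g⟩ = Z_N` is the centre
and `t ∈ 𝔞_{τ g}` (ESTABLISHMENT, ✓`StandardFormTransport`, p821870). The standard-form criterion
(✓`hasNormalSylow_inertia_of_standardForm`, p821758/p821673) now says `I_x` IS p-closed — contradiction.

This is exactly the configuration (`S₃`, `char 2`, `dim 3`) on which the NPC-point game of the dimension-3 design
does not terminate (evidence PHASE0-DIM3-TERMINATION.md on the item): one tame move settles it in all dimensions.

[OURS · crux stmt-ResolutionOfSingularities-15640 · helper toward `stub_phaseZeroHighDim` (an all-dimensional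
SLICE of the stub — groups with a prime-order tame core; NOT a proof of the stub); counted 0; AI-level work,
weaker than expert review.] [folklore]

* `zpowers_eq_of_prime_card` — a non-trivial element of a subgroup of prime order generates it;
* `hcore_of_quotient_isPGroup` — extensions of `p`-groups by `C_ℓ` satisfy the core hypothesis;
* `phaseZero_of_primeCore` — the theorem.
-/

-- single-problem summit: the doubled namespace component `ResolutionOfSingularities` is forced
set_option linter.dupNamespace false

noncomputable section

open CategoryTheory AlgebraicGeometry TopologicalSpace IsLocalRing
open Literature.AlgebraicGeometry.Resolution Literature.AlgebraicGeometry.Ramification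
open Scheme.IdealSheafData
open Summit.ResolutionOfSingularities.ResolutionOfSingularities.Theorems.WildQuotientResolution.PointBlowupStalkData
open Summit.ResolutionOfSingularities.ResolutionOfSingularities.Theorems.WildQuotientResolution.InertLocusStalk

namespace Summit.ResolutionOfSingularities.ResolutionOfSingularities.Theorems.WildQuotientResolution.StandardForm

/-! ## Group theory of the core hypothesis -/

section Group

variable {G : Type} [Group G]

/-- A non-trivial element of a subgroup of prime order generates it. [folklore] -/
theorem zpowers_eq_of_prime_card {N : Subgroup G} (hN : (Nat.card N).Prime) {g : G} (hgN : g ∈ N)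
    (hg : g ≠ 1) : Subgroup.zpowers g = N := by
  haveI : Finite N := Nat.finite_of_card_ne_zero hN.ne_zero
  refine Subgroup.eq_of_le_of_card_ge ((Subgroup.zpowers_le).mpr hgN) ?_
  rw [Nat.card_zpowers]
  rcases (Nat.dvd_prime hN).mp (N.orderOf_dvd_natCard hgN) with h | h
  · exact absurd (orderOf_eq_one_iff.mp h) hg
  · exact h.ge

/-- **Extensions of `p`-groups by `C_ℓ` satisfy the core hypothesis**: if `N ⊴ G` has prime order and `G ⧸ N`
is a `p`-group, then every element of `G` of order prime to `p` lies in `N`, and every subgroup `H` not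
containing `N` meets `N` trivially and is a `p`-group, hence p-closed; so every subgroup without a normal Sylow
`p`-subgroup contains `N` and has its elements of order prime to `p` in `N`. [folklore] -/
theorem hcore_of_quotient_isPGroup (p : ℕ) [hp : Fact p.Prime] [Finite G] (N : Subgroup G) [N.Normal]
    (hN : (Nat.card N).Prime) (hQ : IsPGroup p (G ⧸ N)) (H : Subgroup G) (hH : ¬ HasNormalSylow p H) :
    N ≤ H ∧ ∀ h ∈ H, (orderOf h).Coprime p → h ∈ N := by
  -- elements of order prime to `p` die in the `p`-group `G ⧸ N`, i.e. lie in `N`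
  have htame : ∀ h : G, (orderOf h).Coprime p → h ∈ N := by
    intro h hh
    obtain ⟨k, hk⟩ := hQ (QuotientGroup.mk' N h)
    have h1 : orderOf (QuotientGroup.mk' N h) ∣ p ^ k := orderOf_dvd_of_pow_eq_one hk
    have h2 : orderOf (QuotientGroup.mk' N h) ∣ orderOf h := orderOf_map_dvd _ h
    have h3 : orderOf (QuotientGroup.mk' N h) ∣ Nat.gcd (orderOf h) (p ^ k) := Nat.dvd_gcd h2 h1
    rw [(Nat.Coprime.pow_right k hh).gcd_eq_one, Nat.dvd_one, orderOf_eq_one_iff,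
      QuotientGroup.mk'_apply, QuotientGroup.eq_one_iff] at h3
    exact h3
  refine ⟨?_, fun h _ hh => htame h hh⟩
  by_contra hNH
  -- `H ⊓ N = ⊥`: a subgroup of the prime-order `N` other than `N`
  have hinf : H ⊓ N = ⊥ := by
    rcases (Nat.dvd_prime hN).mp (Subgroup.card_dvd_of_le (inf_le_right : H ⊓ N ≤ N)) with h | h
    · exact (Subgroup.eq_bot_iff_card _).mpr h
    · exact absurd ((Subgroup.eq_of_le_of_card_ge inf_le_right h.ge).symm ▸ inf_le_left) hNH
  -- so `H` is a `p`-group, hence p-closed: contradiction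
  refine hH (HasNormalSylow.of_isPGroup (isPGroup_of_forall_coprime_eq_one fun g hg => ?_))
  have hgN : (g : G) ∈ N := htame g (by rwa [Subgroup.orderOf_coe])
  have hg1 : (g : G) ∈ H ⊓ N := ⟨g.2, hgN⟩
  rw [hinf, Subgroup.mem_bot] at hg1
  exact Subtype.ext hg1

end Group

/-! ## The theorem -/

/-- **Phase 0 in every dimension for groups with a tame core of prime order** (crux
stmt-ResolutionOfSingularities-15640, a SLICE of `stub_phaseZeroHighDim` valid in all dimensions). Let `N ⊴ G`
have prime order `≠ p`, and suppose every subgroup of `G` without a normal Sylow `p`-subgroup contains `N` and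
has its elements of order prime to `p` in `N` (`hcore`; e.g. `G ⧸ N` a `p`-group, `hcore_of_quotient_isPGroup`).
Then for the crux data — `k` of characteristic `p`, `X₁/k` separated of finite type, `X′` integral REGULAR (any
dimension), `q : X′ → X₁` finite, `ρ` a faithful action over `q` — there is an equivariant proper birational
regular model with a `G`-stable affine cover all of whose inertia groups have a normal Sylow `p`-subgroup:
the blow-up of the reduced inert locus `Z_N`. [folklore] -/
theorem phaseZero_of_primeCore (p : ℕ) (hp : p.Prime) (k : Type) [Field k] [CharP k p]
    (X' X₁ : Scheme.{0}) (f : X₁ ⟶ Spec (.of k)) (q : X' ⟶ X₁) (G : Type) [Group G] [Finite G]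
    (ρ : G →* Aut X') (hfaith : Function.Injective ρ)
    [IsSeparated f] [LocallyOfFiniteType f] [QuasiCompact f] [IsIntegral X']
    (hreg : Scheme.IsRegular X') [IsFinite q] (hρ : ∀ g : G, (ρ g).hom ≫ q = q)
    (N : Subgroup G) [N.Normal] (hN : (Nat.card N).Prime) (hNp : Nat.card N ≠ p)
    (hcore : ∀ H : Subgroup G, ¬ HasNormalSylow p H → N ≤ H ∧ ∀ h ∈ H, (orderOf h).Coprime p → h ∈ N) :
    ∃ (Xs : Scheme.{0}) (π : Xs ⟶ X') (ρs : G →* Aut Xs), IsProper π ∧ IsBirational π ∧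
      IsIntegral Xs ∧ Scheme.IsRegular Xs ∧ (∀ g : G, (ρs g).hom ≫ π = π ≫ (ρ g).hom) ∧
      (∀ x : Xs, HasNormalSylow p (inertiaSubgroup ρs x)) ∧
      ∀ x : Xs, ∃ U : Xs.Opens, IsAffineOpen U ∧ x ∈ U ∧ ∀ g : G, (ρs g).hom ⁻¹ᵁ U = U := by
  haveI : Fact p.Prime := ⟨hp⟩
  haveI : IsLocallyNoetherian X' := LocallyOfFiniteType.isLocallyNoetherian (q ≫ f)
  have hcop : (Nat.card N).Coprime p := (Nat.coprime_primes hN hp).mpr hNp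
  have hNbot : N ≠ ⊥ := fun h => hN.one_lt.ne' ((Subgroup.eq_bot_iff_card N).mp h)
  -- residue characteristics of `X′`
  have hcharX : ∀ z : X', CharP (ResidueField (X'.presheaf.stalk z)) p := fun z =>
    (((IsLocalRing.residue (X'.presheaf.stalk z)).comp ((X'.presheaf.germ ⊤ z trivial).hom.comp
      (((q ≫ f).appTop).hom.comp (Scheme.ΓSpecIso (.of k)).inv.hom))).charP_iff_charP p).mp
      inferInstance
  -- THE TAME MOVE along `Z_N`
  obtain ⟨Xs, π, ρs, hπp, hbir, hXs, hXsreg, hequiv, hπ, hle, hcov⟩ :=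
    tameMove p hp k X' X₁ f q G ρ hfaith hreg hρ N hNbot hcop
  haveI := hπp; haveI := hXs
  haveI : IsLocallyNoetherian Xs := LocallyOfFiniteType.isLocallyNoetherian (π ≫ q ≫ f)
  have hZ : IsClosed {y : X' | N ≤ inertiaSubgroup ρ y} :=
    PointMoveNoNpcCurves.isClosed_setOf_le_inertia q ρ hρ N
  set Z : Closeds X' := ⟨{y : X' | N ≤ inertiaSubgroup ρ y}, hZ⟩ with hZdef
  set 𝒥 : X'.IdealSheafData := vanishingIdeal Z with h𝒥def
  -- the exceptional divisor `[π⁻¹𝒥]` is a simple normal crossings boundary on `X♯`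
  have hC : Scheme.IsRegular 𝒥.subscheme :=
    isRegular_subscheme_vanishingIdeal_inertLocus_of_coprime ρ N p hZ (fun x _ => hreg x)
      (fun x _ => hcharX x) hcop
  have hsnc : HasSNC (([] : List X'.IdealSheafData).map (strictTransformIdeal π 𝒥) ++ [𝒥.comap π]) :=
    (hasSNCWith_nil_of_isRegular hreg hC).hasSNC_transform hπ
  set D : Xs.IdealSheafData := 𝒥.comap π with hDdef
  have hDmem : D ∈ ([] : List X'.IdealSheafData).map (strictTransformIdeal π 𝒥) ++ [𝒥.comap π] := by
    simp [hDdef]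
  -- `supp D = π⁻¹ Z_N`, a `G`-stable closed set
  have hDsupp : (D.support : Set Xs) = π.base ⁻¹' {y : X' | N ≤ inertiaSubgroup ρ y} := by
    rw [hDdef, support_comap]
    change π.base ⁻¹' ((𝒥.support : Closeds X') : Set X') = _
    rw [h𝒥def, Scheme.IdealSheafData.coe_support_vanishingIdeal]
    rfl
  have hρs : ∀ g : G, (ρs g).hom ≫ (π ≫ q ≫ f) = π ≫ q ≫ f := fun g => by
    rw [← Category.assoc, hequiv g, Category.assoc, ← Category.assoc (ρ g).hom, hρ g]
  have hDstab : ∀ g : G, (ρs g).hom.base ⁻¹' (D.support : Set Xs) = D.support := by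
    intro g
    have hcomm : π.base ∘ (ρs g).hom.base = (ρ g).hom.base ∘ π.base := by
      funext y
      have e := Scheme.Hom.comp_apply (ρs g).hom π y
      rw [hequiv g, Scheme.Hom.comp_apply] at e
      exact e.symm
    rw [hDsupp, ← Set.preimage_comp, hcomm, Set.preimage_comp, preimage_inertLocus_of_normal ρ g N]
  -- residue characteristics of `X♯`
  have hcharS : ∀ x : Xs, CharP (ResidueField (Xs.presheaf.stalk x)) p := fun x =>
    (((IsLocalRing.residue (Xs.presheaf.stalk x)).comp ((Xs.presheaf.germ ⊤ x trivial).hom.comp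
      (((π ≫ q ≫ f).appTop).hom.comp (Scheme.ΓSpecIso (.of k)).inv.hom))).charP_iff_charP p).mp
      inferInstance
  refine ⟨Xs, π, ρs, hπp, hbir, hXs, hXsreg, hequiv, fun x => ?_, hcov⟩
  haveI := hcharS x
  haveI := hXsreg x
  by_contra hnpc
  obtain ⟨hNle, htameN⟩ := hcore (inertiaSubgroup ρs x) hnpc
  -- `x` lies on the exceptional divisor
  have hπx : π.base x ∈ {y : X' | N ≤ inertiaSubgroup ρ y} := le_trans hNle (hle x)
  have hxD : x ∈ D.support := by
    change x ∈ (D.support : Set Xs)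
    rw [hDsupp]
    exact hπx
  -- the local equation `t` of `E` at `x`: a regular parameter generating `D_x = I(E)_x`
  obtain ⟨hregx, u, hu, ⟨ι, -, hι⟩, -⟩ := hsnc x
  have hrsop : IsRsopPart (u ∘ id) := isRsopPart_comp_of_rsop rfl u hu id Function.injective_id
  set i₀ := ι ⟨D, hDmem, hxD⟩ with hi₀
  set t : Xs.presheaf.stalk x := u i₀ with htdef
  have ht : stalkIdeal D x = Ideal.span {t} := hι ⟨D, hDmem, hxD⟩
  have htm : t ∈ maximalIdeal (Xs.presheaf.stalk x) := hu ▸ Ideal.subset_span ⟨i₀, rfl⟩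
  have ht2 : t ∉ maximalIdeal (Xs.presheaf.stalk x) ^ 2 := hrsop.not_mem_sq i₀
  have htE : stalkIdeal (vanishingIdeal D.support) x = Ideal.span {t} := by
    rw [hsnc.vanishingIdeal_support hDmem, ht]
  -- closed inert loci upstairs (separated invariant structure map `π ≫ q ≫ f`)
  have hZ' : ∀ K : Subgroup G, IsClosed {x' : Xs | K ≤ inertiaSubgroup ρs x'} := fun K =>
    PointMoveNoNpcCurves.isClosed_setOf_le_inertia (π ≫ q ≫ f) ρs hρs K
  -- the standard-form criterion with the single boundary equation `t`
  refine hnpc (hasNormalSylow_inertia_of_standardForm ρs p x fun a τ hkey hτ =>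
    ⟨1, fun _ => t, fun _ => htm, fun _ => ht2, fun g _ => ?_, fun g hg1 hg => ⟨0, ?_⟩⟩)
  · -- (hstab): `E` is `G`-stable, so `κ t̄` is an `I_x`-stable line
    exact apply_mem_span_of_stalkIdeal_eq_span ρs x a τ hkey hτ D.support
      (fun g => hDstab (g : G)) htE g
  · -- (hfix): a tame `g ≠ 1` of `I_x` generates `N`, so the centre `Z_N = Z_⟨g⟩` and `t ∈ 𝔞_{τ g}`
    have hgN : (g : G) ∈ N :=
      htameN (g : G) g.2 (by rwa [Subgroup.orderOf_coe])
    have hg1' : (g : G) ≠ 1 := fun h => hg1 (Subtype.ext h)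
    have hzp : Subgroup.zpowers (g : G) = N := zpowers_eq_of_prime_card hN hgN hg1'
    have hW : {y : X' | Subgroup.zpowers (g : G) ≤ inertiaSubgroup ρ y} ⊆ (Z : Set X') := by
      intro y hy
      rw [Set.mem_setOf_eq, hzp] at hy
      exact hy
    have htD : t ∈ stalkIdeal (𝒥.comap π) x := by
      rw [← hDdef, ht]
      exact Ideal.mem_span_singleton_self t
    exact Ideal.mem_sup_left
      (mem_augIdeal_of_mem_stalkIdeal_comap ρs ρ π hequiv p x a τ hkey hτ g hg g.2 Z le_rfl hW
        (hZ' _) htD)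

/-- **Corollary: extensions of `p`-groups by `C_ℓ`** (`N ⊴ G` of prime order `ℓ ≠ p` with `G ⧸ N` a
`p`-group — `S₃` and `D_ℓ` in characteristic `2`, `C_ℓ ⋊ C_{p^a}`, …): Phase 0 holds for their faithful
actions on regular varieties of every dimension. [folklore] -/
theorem phaseZero_of_quotient_isPGroup (p : ℕ) (hp : p.Prime) (k : Type) [Field k] [CharP k p]
    (X' X₁ : Scheme.{0}) (f : X₁ ⟶ Spec (.of k)) (q : X' ⟶ X₁) (G : Type) [Group G] [Finite G]
    (ρ : G →* Aut X') (hfaith : Function.Injective ρ)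
    [IsSeparated f] [LocallyOfFiniteType f] [QuasiCompact f] [IsIntegral X']
    (hreg : Scheme.IsRegular X') [IsFinite q] (hρ : ∀ g : G, (ρ g).hom ≫ q = q)
    (N : Subgroup G) [N.Normal] (hN : (Nat.card N).Prime) (hNp : Nat.card N ≠ p)
    (hQ : IsPGroup p (G ⧸ N)) :
    ∃ (Xs : Scheme.{0}) (π : Xs ⟶ X') (ρs : G →* Aut Xs), IsProper π ∧ IsBirational π ∧
      IsIntegral Xs ∧ Scheme.IsRegular Xs ∧ (∀ g : G, (ρs g).hom ≫ π = π ≫ (ρ g).hom) ∧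
      (∀ x : Xs, HasNormalSylow p (inertiaSubgroup ρs x)) ∧
      ∀ x : Xs, ∃ U : Xs.Opens, IsAffineOpen U ∧ x ∈ U ∧ ∀ g : G, (ρs g).hom ⁻¹ᵁ U = U :=
  haveI : Fact p.Prime := ⟨hp⟩
  phaseZero_of_primeCore p hp k X' X₁ f q G ρ hfaith hreg hρ N hN hNp
    (hcore_of_quotient_isPGroup p N hN hQ)

end Summit.ResolutionOfSingularities.ResolutionOfSingularities.Theorems.WildQuotientResolution.StandardForm

end
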